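import Summits.BirchSwinnertonDyer.BirchSwinnertonDyer.Theorems.UniversalToricDescentRelaxedKummerPairCount
import HarnessLib

/-!
# The dual index of the relaxed Kummer pair count IS the STRICT-quotient (Weil transport), and the assembled identity
# `#(kummerOutside(T∪V∪∞)/kummerOutside(T∪∞)) · #(H¹_{str T∪∞}/H¹_{str T∪V∪∞}) = ∏_{w∈V} #𝓛_w` from the named Poitou–Tate fact
# (crux ♭T≤ stmt-BirchSwinnertonDyer-23042, line `sigmacongruence`, stub R1 `stub_relaxedImageCount`, brick (a) of the relaxed count road, part 2)

Route `UniversalToricDescent`, lead prover `bsd-wall-utd-p1` g18. THEOREMS ONLY (no definition, no named fact, no `sorry`);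
`--supports stmt-BirchSwinnertonDyer-23042`. BSD is not proved by any of this.

For an elliptic curve `E = W` over a number field `K` ALL OF WHOSE INFINITE PLACES ARE COMPLEX, a prime `p`, `k ≥ 1`, and two disjoint
finite sets `T`, `V` of finite places, consider on `E[p^k]` the Kummer Selmer structures relaxed (`⊤`) on `T ∪ ∞` resp. on `T ∪ V ∪ ∞`
(`kummerRelaxed`, X11b `KummerRelaxedStructures`): `𝓕 ≤ 𝓖`. Howard's Thm. 2.1.11 in counting form (tree
`natCard_selmerQuotient_mul_of_poitouTate`, from the named Poitou–Tate fact `poitouTate_selmerStructure_duality K`) gives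
`#(H¹_𝓖/H¹_𝓕) · #(H¹_{𝓕*}/H¹_{𝓖*}) · ∏ #𝓕_v = ∏ #𝓖_v`, the products differing only on `V` where `#𝓖_w = #H¹(K_w, E[p^k]) = #𝓛_w²`
(Tate) and `#𝓕_w = #𝓛_w` (`𝓛_w` the local Kummer condition, `#𝓛_w = #E(K_w)[p^k] · #(𝓞_w/p^k)`):

(Part 1, `…RelaxedKummerPairCount`: `#(H¹_𝓖/H¹_𝓕) · #(H¹_{𝓕*}/H¹_{𝓖*}) = ∏_{w∈V} #𝓛_w` for a Poitou–Tate family `inv`.)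
* §2 `bijective_weilDualInv_dualSelmerGroup_kummerRelaxed` — the dual Selmer group of `kummerRelaxed(T ∪ ∞)` is, along the inverse Weil transport
  `H¹(w⁻¹) : H¹(K, E[p^k]^D) → H¹(K, E[p^k])`, IN BIJECTION with the `T ∪ ∞`-STRICT Kummer Selmer group `H¹_{kummerStrict(T∪∞)}(K, E[p^k])`
  (`⊤* = 0` by perfectness, `𝓛_w^* = 𝓛_w` Poonen–Rains isotropy + Tate's count, complex places carry no classes) — hence
  **`#(H¹_{𝓕*}/H¹_{𝓖*}) = #(H¹_{str T∪∞}/H¹_{str T∪V∪∞})`** (`natCard_dualQuotient_eq_natCard_strictQuotient`).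
* §3 `natCard_relaxedQuotient_mul_natCard_strictQuotient_eq` — the assembled identity from the named fact:
  **`#(kummerOutside(T∪V∪∞)/kummerOutside(T∪∞)) · #(H¹_{str T∪∞}/H¹_{str T∪V∪∞}) = ∏_{w∈V} #𝓛_w`** — no `inv` in the statement.

On the route (`K_n` a layer of the anticyclotomic tower, `T` = places over `3` and over `S`, `V` = places over `v`): the first factor counts the
image of the relaxed-above-`3` classes in the local groups at `V` (the `v`-signature after transport to `Y^{S∪v}`), the second is the DUAL TERM
`D′_n`, a quotient of the `3`-STRICT Selmer group — strict at both primes above `3`, the point of the relaxed count road (memo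
`Cruxes/DefectTransportModThreePT/Lines/sigmacongruence-relaxed-count-road.md` §2(a),(d)).

References: [MilneADT2006] I Thm. 4.10, Lemma 3.3, Cor. 2.3, Cor. 3.4; [Howard2004HeegnerKolyvagin] Def. 2.1.6, 2.1.10, Thm. 2.1.11;
[GreenbergVatsal2000] §2 Prop. (2.1); [PoonenRains2012] Prop. 4.10.
-/

set_option linter.dupNamespace false
set_option autoImplicit false

noncomputable section
open scoped Classical
open CategoryTheory Field NumberField IsDedekindDomain Function
open Literature.NumberTheory.EllipticCurves Literature.NumberTheory.EllipticCurves.GreenbergSelmer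
open Literature.NumberTheory.GaloisRepresentations
open Literature.NumberTheory.GaloisRepresentations.DiscreteGaloisModule (SelmerStructure tateDual)
open Literature.NumberTheory.GaloisCohomology
open scoped ContRepresentation

namespace Summit.BirchSwinnertonDyer.BirchSwinnertonDyer.Theorems.UniversalToricDescentRelaxedKummerPairCount

open Summit.BirchSwinnertonDyer.Rank1Residual.X11b.KummerPT Summit.BirchSwinnertonDyer.Rank1Residual.X11b.LocBridge
  Summit.BirchSwinnertonDyer.Rank1Residual.X11b.Levels Summit.BirchSwinnertonDyer.Rank1Residual.X11b.AcSelmer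
  Summit.BirchSwinnertonDyer.Rank1Residual.X11b.Relaxation Summit.BirchSwinnertonDyer.Rank1Residual.X11b.SelmerLevelBound
  Summit.BirchSwinnertonDyer.BirchSwinnertonDyer.Theorems.SignedEC.RelaxedKummerCount

variable {K : Type} [Field K] [NumberField K] (W : WeierstrassCurve K) [W.IsElliptic] (p k : ℕ)
  [Fact p.Prime]

/-! ## §2 The dual Selmer groups of the relaxed Kummer structures are the strict Kummer Selmer groups (Weil transport) -/

section Weil

variable (e : W.geomTorsion ((p ^ k : ℕ) : ℤ) → W.geomTorsion ((p ^ k : ℕ) : ℤ) → AlgebraicClosure K)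
  (hμ : ∀ S T, e S T ^ (p ^ k) = 1)
  (hadd₁ : ∀ S₁ S₂ T, e (S₁ + S₂) T = e S₁ T * e S₂ T)
  (hadd₂ : ∀ S T₁ T₂, e S (T₁ + T₂) = e S T₁ * e S T₂)
  (hgal : ∀ (σ : absoluteGaloisGroup K) (S T : W.geomTorsion ((p ^ k : ℕ) : ℤ)), σ • e S T = e (σ • S) (σ • T))
  (halt : ∀ T, e T T = 1) (hnondeg : ∀ T, (∀ S, e S T = 1) → T = 0)

include halt hnondeg in
/-- **The inverse Weil transport identifies `H¹_{(kummerRelaxed S')^*}(K, E[p^k]^D)` with `H¹_{kummerStrict S'}(K, E[p^k])`**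
for every finite `S'` (all infinite places complex): `y ↦ H¹(w⁻¹) y` is injective (`H¹(w)` is a two-sided inverse), lands in the
strict group (`⊤* = 0` by perfectness, `𝓛_v^* ↦ 𝓛_v`), and every strict class `x` is hit by `y = H¹(w) x` (which is a dual class:
`⟨a, H¹(w)(loc x)⟩_v = inv_v(a ∪ₑ loc_v x) = 0` for `a ∈ 𝓛_v` by the Poonen–Rains isotropy, and `= 0` trivially where `loc_v x = 0`).
Stated as: the map is a bijection onto the strict group. [cite: MilneADT2006, Ch. I, Cor. 3.4 and §6 proof of Prop. 6.9]
[cite: Howard2004HeegnerKolyvagin, Def. 2.1.6, 2.1.10 (arXiv:1202.6340 pp. 5–6)] [cite: PoonenRains2012, Prop. 4.10] -/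
theorem bijective_weilDualInv_dualSelmerGroup_kummerRelaxed [Finite (W.geomTorsion ((p ^ k : ℕ) : ℤ))] (hk : 0 < k)
    (hK : ∀ w : InfinitePlace K, w.IsComplex)
    {inv : LocalInvariants K (p ^ k)} (hperf : inv.IsPerfect) (S' : Finset (Place K)) :
    ∃ Ψ : (inv.dualSelmerStructure (W.torsionGaloisModule ((p ^ k : ℕ) : ℤ)) (kummerRelaxed W (p ^ k) S')).selmerGroup →
        (kummerStrict W (p ^ k) S').selmerGroup,
      Function.Bijective Ψ ∧ ∀ y, ((Ψ y : (kummerStrict W (p ^ k) S').selmerGroup) :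
          galoisCohomology (W.torsionGaloisModule ((p ^ k : ℕ) : ℤ)) 1) =
        galoisCohomology.map (weilDualInv W (p ^ k) e hμ hadd₁ hadd₂ hgal hnondeg) 1 y := by
  classical
  have hprime : p.Prime := Fact.out
  haveI : NeZero (p ^ k) := ⟨pow_ne_zero k hprime.ne_zero⟩
  have hpp : IsPrimePow (p ^ k) := ⟨p, k, hprime.prime, hk, rfl⟩
  have hEuler : ∀ v : HeightOneSpectrum (𝓞 K),
      Nat.card (galoisCohomology ((W.torsionGaloisModule ((p ^ k : ℕ) : ℤ)).toLocal (Sum.inr v)) 1) =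
        (Nat.card (nsmulAddMonoidHom (p ^ k) :
            (W.baseChange (v.adicCompletion K)).toAffine.Point →+ _).ker *
          Nat.card (v.adicCompletionIntegers K ⧸
            Ideal.span {((p ^ k : ℕ) : v.adicCompletionIntegers K)})) ^ 2 := fun v ↦
    natCard_galoisCohomology_one_torsion_adicCompletion_eq_sqEP W v (p ^ k) hpp
  set ρ := W.torsionGaloisModule ((p ^ k : ℕ) : ℤ) with hρ
  set 𝓕 : SelmerStructure ρ := kummerRelaxed W (p ^ k) S' with h𝓕def
  have hMn : ∀ m : W.geomTorsion ((p ^ k : ℕ) : ℤ), (p ^ k) • m = 0 := fun m ↦ AddSubgroup.torsionBy.nsmul m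
  -- `⊤* = 0` at the finite places (perfectness)
  have htopdual : ∀ (v : HeightOneSpectrum (𝓞 K))
      (yv : galoisCohomology ((ρ.tateDual (p ^ k)).toLocal (Sum.inr v)) 1),
      yv ∈ inv.dualLocalCondition ρ (Sum.inr v) ⊤ → yv = 0 := by
    intro v yv hyv
    rw [LocalInvariants.mem_dualLocalCondition_iff] at hyv
    refine ((hperf v).2 ρ hMn).2.1 (AddMonoidHom.ext fun a => ?_)
    rw [map_zero, AddMonoidHom.zero_apply, AddMonoidHom.flip_apply]
    exact hyv a (AddSubgroup.mem_top a)
  -- naturality of localisation for the two Weil maps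
  have hlocinv : ∀ (v : Place K) (y : galoisCohomology (ρ.tateDual (p ^ k)) 1),
      galoisCohomology.localization ρ v 1 (galoisCohomology.map (weilDualInv W (p ^ k) e hμ hadd₁ hadd₂ hgal hnondeg) 1 y) =
        galoisCohomology.map ((weilDualInv W (p ^ k) e hμ hadd₁ hadd₂ hgal hnondeg).restrictField (Place.Completion v)) 1
          (galoisCohomology.localization (ρ.tateDual (p ^ k)) v 1 y) := fun v y ↦
    galoisCohomology.res_map_one (Place.Completion v) (weilDualInv W (p ^ k) e hμ hadd₁ hadd₂ hgal hnondeg) y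
  have hlocw : ∀ (v : Place K) (x : galoisCohomology ρ 1),
      galoisCohomology.localization (ρ.tateDual (p ^ k)) v 1
          (galoisCohomology.map (weilDualIntertwining W (p ^ k) e hμ hadd₁ hadd₂ hgal) 1 x) =
        galoisCohomology.map ((weilDualIntertwining W (p ^ k) e hμ hadd₁ hadd₂ hgal).restrictField (Place.Completion v)) 1
          (galoisCohomology.localization ρ v 1 x) := fun v x ↦
    galoisCohomology.res_map_one (Place.Completion v) (weilDualIntertwining W (p ^ k) e hμ hadd₁ hadd₂ hgal) x
  -- into the strict group
  have hto : ∀ y ∈ (inv.dualSelmerStructure ρ 𝓕).selmerGroup,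
      galoisCohomology.map (weilDualInv W (p ^ k) e hμ hadd₁ hadd₂ hgal hnondeg) 1 y ∈ (kummerStrict W (p ^ k) S').selmerGroup := by
    intro y hy
    rw [SelmerStructure.mem_selmerGroup_iff] at hy ⊢
    intro v
    cases v with
    | inl w =>
      rw [localization_inl_eq_zero_of_isComplex _ (hK w)]
      exact zero_mem _
    | inr v =>
      rw [hlocinv]
      have hyv := hy (Sum.inr v)
      rw [LocalInvariants.dualSelmerStructure_apply, h𝓕def] at hyv
      by_cases hv : (Sum.inr v : Place K) ∈ S'
      · rw [kummerRelaxed_of_mem W (p ^ k) S' hv] at hyv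
        rw [kummerStrict_of_mem W (p ^ k) S' hv, htopdual v _ hyv, AddSubgroup.mem_bot]
        exact map_zero _
      · rw [kummerRelaxed_of_not_mem W (p ^ k) S' hv] at hyv
        rw [kummerStrict_of_not_mem W (p ^ k) S' hv]
        exact map_weilDualInv_mem_kummer_of_mem_dualLocalCondition W (p ^ k) e hμ hadd₁ hadd₂ hgal halt
          hnondeg inv v (hperf v).1.1 (hEuler v) hyv
  -- from the strict group
  have hfrom : ∀ x ∈ (kummerStrict W (p ^ k) S').selmerGroup,
      galoisCohomology.map (weilDualIntertwining W (p ^ k) e hμ hadd₁ hadd₂ hgal) 1 x ∈ (inv.dualSelmerStructure ρ 𝓕).selmerGroup := by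
    intro x hx
    rw [SelmerStructure.mem_selmerGroup_iff] at hx ⊢
    intro v
    cases v with
    | inl w =>
      rw [localization_inl_eq_zero_of_isComplex _ (hK w)]
      exact zero_mem _
    | inr v =>
      rw [hlocw, LocalInvariants.dualSelmerStructure_apply, LocalInvariants.mem_dualLocalCondition_iff]
      intro a ha
      rw [localTatePairingZMod_map_weilDual W (p ^ k) e hμ hadd₁ hadd₂ hgal (Sum.inr v) (inv (Sum.inr v)) a,
        ← invWeilPairing_apply]
      have hxv := hx (Sum.inr v)
      by_cases hv : (Sum.inr v : Place K) ∈ S'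
      · rw [kummerStrict_of_mem W (p ^ k) S' hv, AddSubgroup.mem_bot] at hxv
        rw [hxv, map_zero]
      · rw [kummerStrict_of_not_mem W (p ^ k) S' hv] at hxv
        rw [h𝓕def, kummerRelaxed_of_not_mem W (p ^ k) S' hv] at ha
        exact invWeilPairing_eq_zero_of_mem W (p ^ k) e hμ hadd₁ hadd₂ hgal halt inv (Sum.inr v) ha hxv
  refine ⟨fun y ↦ ⟨galoisCohomology.map (weilDualInv W (p ^ k) e hμ hadd₁ hadd₂ hgal hnondeg) 1 y, hto y.1 y.2⟩, ⟨?_, ?_⟩,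
    fun _ ↦ rfl⟩
  · intro y y' h
    apply Subtype.ext
    exact map_injective_of_comp_eq _ _ (weilDualIntertwining_weilDualInv W (p ^ k) e hμ hadd₁ hadd₂ hgal hnondeg)
      (congrArg Subtype.val h)
  · intro x
    refine ⟨⟨galoisCohomology.map (weilDualIntertwining W (p ^ k) e hμ hadd₁ hadd₂ hgal) 1 x, hfrom x.1 x.2⟩, Subtype.ext ?_⟩
    exact map_weilDualInv_map_weilDual W (p ^ k) e hμ hadd₁ hadd₂ hgal hnondeg x

end Weil

/-- **The dual index is the strict index: `#(H¹_{𝓕*}/H¹_{𝓖*}) = #(H¹_{str T∪∞}/H¹_{str T∪V∪∞})`** for `𝓕 = kummerRelaxed (T∪∞)`,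
`𝓖 = kummerRelaxed (T∪V∪∞)` on `E[p^k]` (all infinite places complex, `inv` perfect): the Weil bijection of §2 for `T ∪ ∞` carries the
dual group of `𝓖` exactly onto the group strict also on `V`. [cite: MilneADT2006, Ch. I, Cor. 3.4 and §6 proof of Prop. 6.9]
[cite: Howard2004HeegnerKolyvagin, Def. 2.1.10 (arXiv:1202.6340 p. 6)] -/
theorem natCard_dualQuotient_eq_natCard_strictQuotient [Finite (W.geomTorsion ((p ^ k : ℕ) : ℤ))] (hk : 0 < k)
    (hK : ∀ w : InfinitePlace K, w.IsComplex)
    {inv : LocalInvariants K (p ^ k)} (hperf : inv.IsPerfect) (T V : Finset (HeightOneSpectrum (𝓞 K))) :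
    Nat.card ((inv.dualSelmerStructure (W.torsionGaloisModule ((p ^ k : ℕ) : ℤ))
          (kummerRelaxed W (p ^ k) (T.image Sum.inr ∪ Finset.univ.image Sum.inl))).selmerGroup ⧸
        ((inv.dualSelmerStructure (W.torsionGaloisModule ((p ^ k : ℕ) : ℤ))
          (kummerRelaxed W (p ^ k) ((T.image Sum.inr ∪ Finset.univ.image Sum.inl) ∪ V.image Sum.inr))).selmerGroup).addSubgroupOf
          (inv.dualSelmerStructure (W.torsionGaloisModule ((p ^ k : ℕ) : ℤ))
            (kummerRelaxed W (p ^ k) (T.image Sum.inr ∪ Finset.univ.image Sum.inl))).selmerGroup) =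
      Nat.card ((kummerStrict W (p ^ k) (T.image Sum.inr ∪ Finset.univ.image Sum.inl)).selmerGroup ⧸
        ((kummerStrict W (p ^ k) ((T.image Sum.inr ∪ Finset.univ.image Sum.inl) ∪ V.image Sum.inr)).selmerGroup).addSubgroupOf
          (kummerStrict W (p ^ k) (T.image Sum.inr ∪ Finset.univ.image Sum.inl)).selmerGroup) := by
  classical
  have hprime : p.Prime := Fact.out
  haveI : NeZero (p ^ k) := ⟨pow_ne_zero k hprime.ne_zero⟩
  have hp2 : 2 ≤ p ^ k := le_trans hprime.two_le (Nat.le_self_pow hk.ne' p)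
  set R : Finset (Place K) := Finset.univ.image Sum.inl with hR
  set ST : Finset (Place K) := T.image Sum.inr ∪ R with hST
  set SG : Finset (Place K) := ST ∪ V.image Sum.inr with hSG
  set ρ := W.torsionGaloisModule ((p ^ k : ℕ) : ℤ) with hρ
  have hMn : ∀ m : W.geomTorsion ((p ^ k : ℕ) : ℤ), (p ^ k) • m = 0 := fun m ↦ AddSubgroup.torsionBy.nsmul m
  -- a Weil pairing at level `p^k`
  have hchar : ((p ^ k : ℕ) : K) ≠ 0 := Nat.cast_ne_zero.mpr (pow_ne_zero _ hprime.ne_zero)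
  -- finiteness of the relaxed dual group (it injects into a Kummer group)
  haveI hfinF : Finite (kummerStrict W (p ^ k) ST).selmerGroup := by
    haveI : Finite (kummerOutside W (p ^ k) ST) := finite_kummerOutside W (p ^ k) ST
    have hmem : ∀ x : (kummerStrict W (p ^ k) ST).selmerGroup, (x : galoisCohomology ρ 1) ∈ kummerOutside W (p ^ k) ST := by
      intro x
      rw [← selmerGroup_kummerRelaxed]
      have hx := x.2
      rw [SelmerStructure.mem_selmerGroup_iff] at hx ⊢
      exact fun v ↦ kummerStrict_le_kummerRelaxed W (p ^ k) ST v (hx v)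
    exact Finite.of_injective (fun x : (kummerStrict W (p ^ k) ST).selmerGroup ↦
      (⟨(x : galoisCohomology ρ 1), hmem x⟩ : kummerOutside W (p ^ k) ST))
      fun x y h ↦ Subtype.ext (congrArg (fun z : kummerOutside W (p ^ k) ST ↦ (z : galoisCohomology ρ 1)) h)
  obtain ⟨e, hμ, hadd₁, hadd₂, halt, hnondeg, hgal⟩ := W.exists_weilPairing_holds (p ^ k) hp2 hchar
  obtain ⟨Ψ, hΨ, hΨval⟩ := bijective_weilDualInv_dualSelmerGroup_kummerRelaxed W p k e hμ hadd₁ hadd₂ hgal halt hnondeg hk hK hperf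
    ST
  haveI : Finite (inv.dualSelmerStructure ρ (kummerRelaxed W (p ^ k) ST)).selmerGroup := Finite.of_injective Ψ hΨ.1
  refine natCard_quotient_eq_of_bijective
    (LocalInvariants.selmerGroup_dualSelmerStructure_anti inv ρ (fun v ↦ ?_))
    (fun x hx ↦ ?_) Ψ hΨ (fun y ↦ ?_)
  · -- `𝓕 ≤ 𝓖`
    by_cases hv : v ∈ ST
    · rw [kummerRelaxed_of_mem W (p ^ k) ST hv, kummerRelaxed_of_mem W (p ^ k) SG (Finset.mem_union_left _ hv)]
    · rw [kummerRelaxed_of_not_mem W (p ^ k) ST hv]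
      by_cases hv' : v ∈ SG
      · rw [kummerRelaxed_of_mem W (p ^ k) SG hv']; exact le_top
      · rw [kummerRelaxed_of_not_mem W (p ^ k) SG hv']
  · -- `str SG ≤ str ST`
    rw [SelmerStructure.mem_selmerGroup_iff] at hx ⊢
    intro v
    have hxv := hx v
    by_cases hv : v ∈ ST
    · rw [kummerStrict_of_mem W (p ^ k) SG (Finset.mem_union_left _ hv)] at hxv
      rw [kummerStrict_of_mem W (p ^ k) ST hv]; exact hxv
    · rw [kummerStrict_of_not_mem W (p ^ k) ST hv]
      by_cases hv' : v ∈ SG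
      · rw [kummerStrict_of_mem W (p ^ k) SG hv', AddSubgroup.mem_bot] at hxv
        rw [hxv]; exact zero_mem _
      · rw [kummerStrict_of_not_mem W (p ^ k) SG hv'] at hxv; exact hxv
  · -- membership compatibility: `Ψ y` strict also on `V` iff `y` dual for `𝓖`
    have hy := y.2
    rw [SelmerStructure.mem_selmerGroup_iff] at hy
    have hΨy := (Ψ y).2
    rw [SelmerStructure.mem_selmerGroup_iff] at hΨy
    rw [SelmerStructure.mem_selmerGroup_iff, SelmerStructure.mem_selmerGroup_iff]
    have hloc : ∀ v : Place K, galoisCohomology.localization ρ v 1 ((Ψ y : (kummerStrict W (p ^ k) ST).selmerGroup) : galoisCohomology ρ 1) =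
        galoisCohomology.map ((weilDualInv W (p ^ k) e hμ hadd₁ hadd₂ hgal hnondeg).restrictField (Place.Completion v)) 1
          (galoisCohomology.localization (ρ.tateDual (p ^ k)) v 1 (y : galoisCohomology (ρ.tateDual (p ^ k)) 1)) := fun v ↦ by
      rw [hΨval]
      exact galoisCohomology.res_map_one (Place.Completion v) (weilDualInv W (p ^ k) e hμ hadd₁ hadd₂ hgal hnondeg) _
    constructor
    · intro h v
      rw [LocalInvariants.dualSelmerStructure_apply]
      by_cases hvV : v ∈ V.image Sum.inr
      · -- on `V`: `𝓖 = ⊤`, need `loc_v y ∈ ⊤* = {pairs to 0 with everything}`; `loc_v (Ψ y) = 0` and `H¹(w⁻¹|_v)` injective ⟹ `loc_v y = 0`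
        have hvSG : v ∈ SG := Finset.mem_union_right _ hvV
        rw [kummerRelaxed_of_mem W (p ^ k) SG hvSG, LocalInvariants.mem_dualLocalCondition_iff]
        have h0 := h v
        rw [kummerStrict_of_mem W (p ^ k) SG hvSG, AddSubgroup.mem_bot, hloc] at h0
        have hinjloc : Function.Injective
            (galoisCohomology.map ((weilDualInv W (p ^ k) e hμ hadd₁ hadd₂ hgal hnondeg).restrictField (Place.Completion v)) 1) :=
          Function.LeftInverse.injective
            (map_weilDual_map_weilDualInv_restrictField W (p ^ k) e hμ hadd₁ hadd₂ hgal hnondeg (Place.Completion v))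
        have hy0 : galoisCohomology.localization (ρ.tateDual (p ^ k)) v 1 (y : galoisCohomology (ρ.tateDual (p ^ k)) 1) = 0 :=
          hinjloc (h0.trans (AddMonoidHom.map_zero _).symm)
        intro a _
        rw [hy0, map_zero]
      · have hvG : kummerRelaxed W (p ^ k) SG v = kummerRelaxed W (p ^ k) ST v := by
          by_cases hv : v ∈ ST
          · rw [kummerRelaxed_of_mem W (p ^ k) ST hv, kummerRelaxed_of_mem W (p ^ k) SG (Finset.mem_union_left _ hv)]
          · have hvSG : v ∉ SG := fun h' ↦ by
              rcases Finset.mem_union.mp h' with h' | h'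
              · exact hv h'
              · exact hvV h'
            rw [kummerRelaxed_of_not_mem W (p ^ k) ST hv, kummerRelaxed_of_not_mem W (p ^ k) SG hvSG]
        rw [hvG]
        have := hy v
        rwa [LocalInvariants.dualSelmerStructure_apply] at this
    · intro h v
      by_cases hvV : v ∈ V.image Sum.inr
      · have hvSG : v ∈ SG := Finset.mem_union_right _ hvV
        rw [kummerStrict_of_mem W (p ^ k) SG hvSG, AddSubgroup.mem_bot, hloc]
        have hyv := h v
        rw [LocalInvariants.dualSelmerStructure_apply, kummerRelaxed_of_mem W (p ^ k) SG hvSG] at hyv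
        -- `⊤* = 0`
        cases v with
        | inl w =>
          rw [localization_inl_eq_zero_of_isComplex _ (hK w)]
          exact map_zero _
        | inr v =>
          have hy0 : galoisCohomology.localization (ρ.tateDual (p ^ k)) (Sum.inr v) 1 (y : galoisCohomology (ρ.tateDual (p ^ k)) 1) = 0 := by
            rw [LocalInvariants.mem_dualLocalCondition_iff] at hyv
            refine ((hperf v).2 ρ hMn).2.1 (AddMonoidHom.ext fun a => ?_)
            rw [map_zero, AddMonoidHom.zero_apply, AddMonoidHom.flip_apply]
            exact hyv a (AddSubgroup.mem_top a)
          rw [hy0]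
          exact map_zero _
      · have hvG : kummerStrict W (p ^ k) SG v = kummerStrict W (p ^ k) ST v := by
          by_cases hv : v ∈ ST
          · rw [kummerStrict_of_mem W (p ^ k) ST hv, kummerStrict_of_mem W (p ^ k) SG (Finset.mem_union_left _ hv)]
          · have hvSG : v ∉ SG := fun h' ↦ by
              rcases Finset.mem_union.mp h' with h' | h'
              · exact hv h'
              · exact hvV h'
            rw [kummerStrict_of_not_mem W (p ^ k) ST hv, kummerStrict_of_not_mem W (p ^ k) SG hvSG]
        rw [hvG]
        exact hΨy v

/-! ## §3 Assembly from the named Poitou–Tate fact -/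

/-- **`#(kummerOutside(T∪V∪∞)/kummerOutside(T∪∞)) · #(H¹_{str T∪∞}/H¹_{str T∪V∪∞}) = ∏_{w∈V} #𝓛_w`** for `E[p^k]` (`k ≥ 1`) over a
number field all of whose infinite places are complex, `T`, `V` disjoint finite sets of finite places, GIVEN the named fact
`poitouTate_selmerStructure_duality K` (Milne I Thm. 4.10 / Howard 2004 Thm. 2.1.11): §1 for the family the fact provides, with its dual
index rewritten by §2. (`kummerOutside W (p^k) S' = H¹_{kummerRelaxed S'}`, `selmerGroup_kummerRelaxed`.)
[cite: MilneADT2006, Ch. I, Thm. 4.10, Lemma 3.3] [cite: Howard2004HeegnerKolyvagin, Thm. 2.1.11 (arXiv:1202.6340 p. 6)] -/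
theorem natCard_relaxedQuotient_mul_natCard_strictQuotient_eq (hk : 0 < k) (hK : ∀ w : InfinitePlace K, w.IsComplex)
    (hPT : poitouTate_selmerStructure_duality K) (T V : Finset (HeightOneSpectrum (𝓞 K))) (hTV : Disjoint T V) :
    Nat.card ((kummerRelaxed W (p ^ k) ((T.image Sum.inr ∪ Finset.univ.image Sum.inl) ∪ V.image Sum.inr)).selmerGroup ⧸
        ((kummerRelaxed W (p ^ k) (T.image Sum.inr ∪ Finset.univ.image Sum.inl)).selmerGroup).addSubgroupOf
          (kummerRelaxed W (p ^ k) ((T.image Sum.inr ∪ Finset.univ.image Sum.inl) ∪ V.image Sum.inr)).selmerGroup) *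
      Nat.card ((kummerStrict W (p ^ k) (T.image Sum.inr ∪ Finset.univ.image Sum.inl)).selmerGroup ⧸
        ((kummerStrict W (p ^ k) ((T.image Sum.inr ∪ Finset.univ.image Sum.inl) ∪ V.image Sum.inr)).selmerGroup).addSubgroupOf
          (kummerStrict W (p ^ k) (T.image Sum.inr ∪ Finset.univ.image Sum.inl)).selmerGroup) =
      ∏ w ∈ V, Nat.card (W.kummerSelmerStructure ((p ^ k : ℕ) : ℤ) (Sum.inr w)) := by
  haveI : NeZero (p ^ k) := ⟨pow_ne_zero k (Fact.out : p.Prime).ne_zero⟩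
  haveI : Finite (W.geomTorsion ((p ^ k : ℕ) : ℤ)) := finite_geomTorsion_pow W p k
  obtain ⟨inv, hperf, hsum, -, hcompl⟩ := hPT (p ^ k)
  rw [← natCard_dualQuotient_eq_natCard_strictQuotient W p k hk hK hperf T V]
  exact natCard_quotient_mul_natCard_dualQuotient_eq W p k hk hperf hsum hcompl T V hTV

end Summit.BirchSwinnertonDyer.BirchSwinnertonDyer.Theorems.UniversalToricDescentRelaxedKummerPairCount

end
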